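import Literature.Claims.NS.Zhai2014
import HarnessLib

/-!
# Solo refutation aid — C18 `Zhai2014` (arXiv 1409.7868 v3; v4 = author's withdrawal
«crucial error in section 6»), refuter lane ns-claims-refuter-5

Kernel facts about the typed skeleton `Literature.Claims.NS.Zhai2014` (p474675):

* `not_Step_7a` — the PRINTED Step 1 of the proof of Lemma 6.2, (6.9.1) «dE/dh < −D(h)»
  (v3 TeX l.2153–2159, print p.34), typed at the abstract grain over `Displayed`, is false: (3.38)
  `E′ ≤ −D·bracket` with a bracket in `(0,1)` does not give `E′ < −D`. Countermodel:
  `E(h) = ((2−h)/4)²`, `E′ = −D = −(2−h)/8`, `G₁ = Q⁺ = Hi = 0`, `T = 2`, `t = 1`, `h₀ = ½`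
  (then `bracket(h) = (2+h)/4`). The charitable `Step_7a'` («dE/dh < 0», what (6.9.2) uses) is
  not touched by this witness (typo-level; see the verdict line for the class of record).
* `not_RestartWindow`, `not_QPlusPropagation` — the two real-number grains (F15 companions, NOT
  printed steps) of the closure «return to the Step 1 by replacing h₀ by h₁» (l.2219–2223, p.35)
  are false: Prop. 5.1's restart window at `h₁` is shorter than `h₀ = T^{1+4γ₁}` (instance
  `M₂ = 1, γ₁ = 1/200, δ̂ = 1/4, T = 2⁻⁴⁰⁰`; first kernel countermodel: ns-claims-ref-4 g2,
  `claims/Zhai2014/kill-aid-Zhai2014.ref4-scratch.lean`, re-proved here), and the `u^{Q+}`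
  smallness (c) of (3.38) is not propagated by the monotonicity of `E` (`200·‖u₀‖₂^{−ε/2} > 1 ≥
  ‖u₀‖₂^{ε_b(1+4α)}`).
* `not_shellOrdering_of_printed` — the print inconsistency l.1846–1849 («1 < ε_c < 2») versus
  (3.35)/(6.8.0) (`ε_c = ½`): under `Params.Printed` the shell ordering (3.29.1) cannot hold.

WHAT THIS IS NOT: not a claim about NS regularity or blow-up; not a claim about any author
beyond the typed locator.
-/

set_option linter.dupNamespace false

open Set

namespace Summit.NavierStokesRegularity.NavierStokesRegularity.Theorems.Zhai2014

open Literature.Claims.NS.Zhai2014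

noncomputable section

/-! ## Step 7a — the printed (6.9.1) «dE/dh < −D» at the abstract grain -/

/-- The displayed functions of the countermodel: `E(h) = ((2−h)/4)²`, `E′(h) = −(2−h)/8`,
`D(h) = (2−h)/8`, `G₁ = Q⁺ = Hi = 0`. [folklore] -/
def X7a : Displayed where
  E h := ((2 - h) / 4) ^ 2
  E' h := -((2 - h) / 8)
  D h := (2 - h) / 8
  G₁ _ := 0
  Qp _ := 0
  Hi _ := 0

/-- Parameters for the countermodel (their values play no role: `Step_7a` carries no
`Params.Printed` hypothesis, and the `G₁`, `Q⁺`, `Hi` terms vanish). [folklore] -/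
def P7a : Params := ⟨1 / 24, 1 / 200, 1, 3 / 2, 1 / 2, 1 / 4⟩

/-- Scales for the countermodel: `t = 1` (with `T = 2`, so `T − t = 1`), `β₀ = ¼`, `β₁ = ⅛`,
`b = ¾`. [folklore] -/
def S7a : Scales := ⟨1, 1 / 4, 1 / 8, 3 / 4⟩

/-- With `T = 2`, `t = 1`, `nrm = 1`, `C(α) = 0` the bracket of (3.38) of the countermodel is
`1 − √E(h) = (2+h)/4` for `h ≤ 2`. [cite: Zhai2014, (3.38), p. 33] -/
theorem bracket338_X7a {h : ℝ} (hh : h ≤ 2) :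
    X7a.bracket338 P7a S7a 2 1 0 h = (2 + h) / 4 := by
  have hs : Real.sqrt (((2 - h) / 4) ^ 2) = (2 - h) / 4 := Real.sqrt_sq (by linarith)
  simp only [Displayed.bracket338, X7a, S7a, hs, mul_zero, add_zero, zero_div, sub_zero]
  norm_num
  ring

/-- The bracket of the countermodel is continuous in `h`. [folklore] -/
theorem continuous_bracket338_X7a : Continuous (X7a.bracket338 P7a S7a 2 1 0) := by
  unfold Displayed.bracket338
  simp only [X7a]
  fun_prop

/-- The countermodel satisfies (3.38) on `(0, 2)` (indeed `E′ = −D·1 ≤ −D·bracket` since the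
bracket is `≤ 1` and `D ≥ 0`). [cite: Zhai2014, (3.38), p. 33] -/
theorem ineq338_X7a : X7a.Ineq338 P7a S7a 2 1 0 := by
  intro h hh
  refine ⟨?_, ?_⟩
  · -- `d/dh ((2−h)/4)² = −(2−h)/8`
    have h1 : HasDerivAt (fun x : ℝ => ((2 - x) / 4) ^ 2)
        (((2 : ℕ) : ℝ) * ((2 - h) / 4) ^ (2 - 1) * (-1 / 4)) h :=
      (((hasDerivAt_id h).const_sub 2).div_const 4).pow 2
    have e : ((2 : ℕ) : ℝ) * ((2 - h) / 4) ^ (2 - 1) * (-1 / 4) = -((2 - h) / 8) := by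
      norm_num; ring
    rw [e] at h1
    exact h1
  · rw [bracket338_X7a hh.2.le]
    simp only [X7a]
    nlinarith [hh.1, hh.2]

/-- **Refutation of `Step_7a`** (the printed (6.9.1) «dE/dh < −D(h)», l.2153–2159, p.34, at the
abstract grain): in the countermodel `E′ = −D` exactly, so «E′ < −D» fails at every `h`, while all
hypotheses of `Step_7a` hold at `T = 2`, `t = 1`, `h₀ = ½`. [cite: Zhai2014, (6.9.1), p. 34] -/
theorem not_Step_7a : ¬ Step_7a := by
  intro h7
  have hb0 : 0 < X7a.bracket338 P7a S7a 2 1 0 (1 / 2) := by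
    rw [bracket338_X7a (by norm_num)]; norm_num
  have hD0 : 0 < X7a.D (1 / 2) := by simp only [X7a]; norm_num
  have hDc : ContinuousWithinAt X7a.D (Ici (1 / 2)) (1 / 2) := by
    apply Continuous.continuousWithinAt
    simp only [X7a]
    fun_prop
  obtain ⟨h₁, hh₁, -, hall⟩ := h7 X7a P7a S7a 2 1 0 (1 / 2) (by norm_num)
    (by simp only [S7a]; norm_num) (by simp only [S7a]; norm_num) ineq338_X7a
    continuous_bracket338_X7a.continuousWithinAt hDc hb0 hD0
  have hmid : (1 / 2 + h₁) / 2 ∈ Ioo (1 / 2) h₁ := ⟨by linarith, by linarith⟩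
  have hlt := (hall _ hmid).1
  simp only [X7a] at hlt
  exact lt_irrefl _ hlt

/-! ## The real-number grains of the closure l.2219–2223 (F15 companions) -/

/-- **Refutation of `QPlusPropagation`** (referee R2): at `‖u₀‖₂ = ½`, `α = 1/24`, `ε = 1`,
`ε_b = 3/2` (admissible: `3/2 < 2`, `1/(¾ − 1/24) = 24/17 < 3/2`) the left side is `≥ 200`, the
right side `≤ 1`. (First kernel countermodel: ns-claims-ref-4 g2.) [cite: Zhai2014, (3.38) p. 33 with (3.35) p. 32] -/
theorem not_QPlusPropagation : ¬ QPlusPropagation := by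
  intro h
  have hh := h (1 / 24) 1 (3 / 2) (1 / 2) (by norm_num) (by norm_num) (by norm_num) (by norm_num)
    (by norm_num) (by norm_num) (by norm_num)
  have h1 : (1 : ℝ) ≤ (1 / 2 : ℝ) ^ (-((1 : ℝ) / 2)) :=
    Real.one_le_rpow_of_pos_of_le_one_of_nonpos (by norm_num) (by norm_num) (by norm_num)
  have h2 : (1 / 2 : ℝ) ^ ((3 : ℝ) / 2 * (1 + 4 * (1 / 24))) ≤ 1 :=
    Real.rpow_le_one (by norm_num) (by norm_num) (by norm_num)
  have h3 : (200 : ℝ) ≤ 200 * (1 / 2 : ℝ) ^ (-((1 : ℝ) / 2)) :=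
    le_mul_of_one_le_right (by norm_num) h1
  linarith

/-- `((1/2)^a)^x = (1/2)^(a·x)` for a natural `a` and a real `x`. [folklore] -/
theorem half_pow_rpow (a : ℕ) (x : ℝ) :
    ((1 / 2 : ℝ) ^ a) ^ x = (1 / 2 : ℝ) ^ ((a : ℝ) * x) := by
  rw [← Real.rpow_natCast, ← Real.rpow_mul (by norm_num)]

set_option exponentiation.threshold 1024 in
/-- **Refutation of `RestartWindow`** (referee R1, the window (5.5) of Prop. 5.1 restarted at `h₁`
with `K₀ = ‖u₀‖₂^{-2}` versus `h₀ = T^{1+4γ₁}`): at `M₂ = 1`, `γ₁ = 1/200`, `δ̂ = 1/4`,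
`T = (1/2)^400` (admissible: `T < (1/2)^{1/γ₁} = (1/2)^200`) the left side is `(1/2)^408`, the
right side `7⁴·(1/2)^824`. (First kernel countermodel: ns-claims-ref-4 g2.)
[cite: Zhai2014, (5.5) p. 22 with (6.3) p. 25 and (6.36) p. 35] -/
theorem not_RestartWindow : ¬ RestartWindow := by
  intro h
  have hT : (0 : ℝ) < (1 / 2 : ℝ) ^ (400 : ℕ) := by positivity
  have hTlt : (1 / 2 : ℝ) ^ (400 : ℕ) < (1 / 2 : ℝ) ^ ((1 : ℝ) / (1 / 200)) := by
    have e : (1 : ℝ) / (1 / 200) = ((200 : ℕ) : ℝ) := by norm_num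
    rw [e, Real.rpow_natCast]
    exact pow_lt_pow_right_of_lt_one₀ (by norm_num) (by norm_num) (by norm_num)
  have hh := h 1 (1 / 200) ((1 / 2 : ℝ) ^ (400 : ℕ)) (1 / 4) one_pos (by norm_num) (by norm_num)
    hT hTlt (by norm_num) (by norm_num)
  have e1 : ((1 / 2 : ℝ) ^ (400 : ℕ)) ^ ((1 : ℝ) + 4 * (1 / 200)) = (1 / 2 : ℝ) ^ (408 : ℕ) := by
    rw [half_pow_rpow, show ((400 : ℕ) : ℝ) * ((1 : ℝ) + 4 * (1 / 200)) = ((408 : ℕ) : ℝ) by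
      norm_num, Real.rpow_natCast]
  have e2 : ((1 / 2 : ℝ) ^ (400 : ℕ)) ^ ((1 : ℝ) / 4 - 1 / 200) = (1 / 2 : ℝ) ^ (98 : ℕ) := by
    rw [half_pow_rpow, show ((400 : ℕ) : ℝ) * ((1 : ℝ) / 4 - 1 / 200) = ((98 : ℕ) : ℝ) by
      norm_num, Real.rpow_natCast]
  have e3 : Real.sqrt (1 / 4 : ℝ) = 1 / 2 := by
    rw [show (1 / 4 : ℝ) = (1 / 2) ^ 2 by norm_num]
    exact Real.sqrt_sq (by norm_num)
  rw [e1, e2, e3] at hh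
  have key : (7 * ((1 / 2 : ℝ) ^ (98 : ℕ) * (1 / 2 / 2)) ^ 2 / (64 * 1)) ^ 4
      = (1 / 2 : ℝ) ^ (408 : ℕ) * (2401 / 2 ^ 416) := by
    ring
  rw [key] at hh
  have hlt : (2401 : ℝ) / 2 ^ 416 < 1 := by
    rw [div_lt_one (by positivity)]; norm_num
  have hpos : (0 : ℝ) < (1 / 2 : ℝ) ^ (408 : ℕ) := by positivity
  have h4 := mul_lt_mul_of_pos_left hlt hpos
  rw [mul_one] at h4
  linarith

/-- For FIXED `M₂` the restart window also fails for every sufficiently small `T`, which is the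
regime the rescaling `λ_γ → ∞` of §6.2 forces (`T < 2^{-1/γ₁}`): the two sides are `T^{1+4γ₁}` and
`(7δ̂/(256 M₂))⁴ · T^{2−8γ₁}` with `2 − 8γ₁ > 1 + 4γ₁`; and for fixed `(γ₁, T, δ̂)` it fails for
every large `M₂`. Recorded as the scaling form of `not_RestartWindow`: for any admissible
`(γ₁, T, δ̂)` there is `M₂ > 0` violating the window. [cite: Zhai2014, (5.5) p. 22 with (6.3) p. 25] -/
theorem restartWindow_fails_large_M₂ (γ₁ T δhat : ℝ) (hT : 0 < T) (hδ : 0 < δhat) :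
    ∃ M₂ : ℝ, 0 < M₂ ∧
      (7 * (T ^ (1 / 4 - γ₁) * (Real.sqrt δhat / 2)) ^ 2 / (64 * M₂)) ^ (4 : ℕ) <
        T ^ (1 + 4 * γ₁) := by
  set L : ℝ := T ^ (1 + 4 * γ₁) with hL
  set A : ℝ := 7 * (T ^ (1 / 4 - γ₁) * (Real.sqrt δhat / 2)) ^ 2 / 64 with hA
  have hLpos : 0 < L := Real.rpow_pos_of_pos hT _
  have hApos : 0 < A := by
    have : 0 < T ^ (1 / 4 - γ₁) * (Real.sqrt δhat / 2) :=
      mul_pos (Real.rpow_pos_of_pos hT _) (div_pos (Real.sqrt_pos.mpr hδ) two_pos)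
    positivity
  refine ⟨A * (1 + L⁻¹), by positivity, ?_⟩
  have hq : 7 * (T ^ (1 / 4 - γ₁) * (Real.sqrt δhat / 2)) ^ 2 / (64 * (A * (1 + L⁻¹)))
      = L / (L + 1) := by
    rw [hA]
    field_simp
  rw [hq]
  have hr0 : 0 < L / (L + 1) := by positivity
  have hr1 : L / (L + 1) < 1 := by
    rw [div_lt_one (by positivity)]; linarith
  calc (L / (L + 1)) ^ (4 : ℕ) ≤ (L / (L + 1)) ^ (1 : ℕ) :=
        pow_le_pow_of_le_one hr0.le hr1.le (by norm_num)
    _ = L / (L + 1) := pow_one _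
    _ < L := by
        rw [div_lt_iff₀ (by positivity)]
        nlinarith

/-! ## The print inconsistency on `ε_c` (referee L1) -/

/-- Under the PRINTED parameters ((3.35)/(6.8.0): `ε_c = ½`) the shell ordering (3.29.1) of
l.1846–1849 («`1 < ε_c < 2` will be determined later») cannot hold — whatever the scales and the
norm. [cite: Zhai2014, §6.4 l.1846–1849, p. 30] -/
theorem not_shellOrdering_of_printed (P : Params) (δ : ℝ) (S : Scales) (nrm : ℝ)
    (hP : P.Printed δ) : ¬ ShellOrdering P S nrm := by
  rintro ⟨-, -, hc, -⟩
  rw [hP.ε_c_eq] at hc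
  norm_num at hc

end

end Summit.NavierStokesRegularity.NavierStokesRegularity.Theorems.Zhai2014
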